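import Summits.HodgeConjecture.HodgeConjecture.Theorems.SignSymmetricPowersGenLinSubst
import Summits.HodgeConjecture.HodgeConjecture.Theorems.SignSymmetricPowersMeridianOneNode
import Summits.HodgeConjecture.HodgeConjecture.Theorems.SignSymmetricPowersMeridianIrreducible
import HarnessLib

/-!
# K1-B meridian package, G2 part (h): the orbit families of singular invariant forms — irreducible, inside `V(D_M)`,
# and containing every invariant form with a singular point of the given type
# (route `SignSymmetricPowers`, item stmt-HodgeConjecture-19716; helper for GEN)

Helper file (`--supports stmt-HodgeConjecture-19716`) for the COVERAGE step of GEN (`stub_signMeridianGeneration`; item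
✗4 of prover-B's INDEX: "every prime factor hⱼ carries one of the three witnesses").

Data: a diagonal `γ`, the set `M` of degree-`d` monomials FIXED by `γ` (`m ∈ M ↔ γ^m = 1`), a reference point
`p ≠ 0`, and a finite family `v : Fin r → ℂ[x]` of `M`-supported degree-`d` forms singular at `p` (`∇vₜ(p) = 0`).
The UNIVERSAL ORBIT FAMILY is the polynomial map `(A, b) ↦ coeff_M (A_γ · Σₜ bₜ vₜ)`, where `A_γ` is the matrix `A` with
the entries outside the `γ`-blocks zeroed (so `A_γ` commutes with `diagonal γ` and `A_γ ·` preserves `M`-supported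
forms); its coordinates `orbitFamilyCoeff v m` are polynomials in the matrix entries and the `bₜ` (after the `val-lit`
cell's `FormDiscriminant.singFamilyCoeff`).

* `eval_orbitFamilyCoeff` — specialisation at `(A, b)`;
* `isPrime_vanishingIdeal_range_orbitFamily` — the range has a PRIME vanishing ideal (prover-B's
  `SignSymmetricPowersMeridianIrreducible.isPrime_vanishingIdeal_range`);
* `killHom_mem_vanishingIdeal_range_orbitFamily` — `D_M = killHom Disc` vanishes on the range (every `A_γ · F` is a
  singular `M`-form: `SignSymmetricPowersGenLinSubst`), `d ≥ 2`;
* `mem_range_orbitFamily_of_transit` — an `M`-supported degree-`d` form `f` singular at `z`, with an invertible `N`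
  commuting with `diagonal γ` and `N z = p`, has `coeff_M f` in the range, PROVIDED `v` spans the invariant forms
  singular at `p`.

Sorry-free; axioms standard; no definition, no named fact (the universal family is written out as an explicit
polynomial term in each statement).

## References

* [GelfandKapranovZelevinsky1994] Gelfand–Kapranov–Zelevinsky, Discriminants…, Ch. 1 §1 (the discriminant as the
  closure of an orbit family).
* [Hartshorne1977] R. Hartshorne, Algebraic Geometry, I Ex. 5.8.
-/

noncomputable section

set_option linter.dupNamespace false

open MvPolynomial Matrix
open Literature.AlgebraicGeometry.Motives Literature.AlgebraicGeometry.Motives.UniversalHypersurface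
open Literature.AlgebraicGeometry.HodgeTheory
open Literature.Computability.AlgebraicComplexity
open Summit.HodgeConjecture.HodgeConjecture.Theorems.SignSymmetricPowersGenLinSubst
open Summit.HodgeConjecture.HodgeConjecture.Theorems.SignSymmetricPowersGenDiagonalCoeff
open Summit.HodgeConjecture.HodgeConjecture.Theorems.SignSymmetricPowersMeridianOneNode

namespace Summit.HodgeConjecture.HodgeConjecture.Theorems.SignSymmetricPowersGenSingularFamilies

variable {n d : ℕ} (γ : Fin (n + 2) → ℂˣ) (M : Set (DegIndex n d))

/-! ### §1 Base change for `linSubst` (copy of the private `FormSingularLocusPrime.map_linSubst'`) -/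

/-- `map θ (A · p) = (θ A) · (map θ p)`. [folklore] -/
theorem map_linSubst {σ R S : Type*} [Fintype σ] [CommRing R] [CommRing S] (θ : R →+* S)
    (A : Matrix σ σ R) (p : MvPolynomial σ R) :
    MvPolynomial.map θ (linSubst σ R A p) = linSubst σ S (A.map θ) (MvPolynomial.map θ p) := by
  change MvPolynomial.map θ (aeval _ p) = aeval _ (MvPolynomial.map θ p)
  rw [aeval_eq_bind₁, aeval_eq_bind₁, map_bind₁]
  congr 2
  funext i
  simp only [map_sum, smul_eq_C_mul, map_mul, map_C, map_X, Matrix.map_apply]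

/-! ### §2 Block matrices -/

/-- A matrix with zero entries outside the `γ`-blocks commutes with `diagonal γ`. [folklore] -/
theorem blockify_commute (A : Matrix (Fin (n + 2)) (Fin (n + 2)) ℂ) :
    (Matrix.of fun i j => if γ i = γ j then A i j else 0) * Matrix.diagonal (fun i => (γ i : ℂ)) =
      Matrix.diagonal (fun i => (γ i : ℂ)) * Matrix.of fun i j => if γ i = γ j then A i j else 0 := by
  ext i j
  rw [mul_diagonal, diagonal_mul, Matrix.of_apply]
  split_ifs with h
  · rw [h, mul_comm]
  · simp

/-- A matrix commuting with `diagonal γ` has zero entries outside the `γ`-blocks, so it equals its blockification.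
[folklore] -/
theorem blockify_eq_of_commute {A : Matrix (Fin (n + 2)) (Fin (n + 2)) ℂ}
    (hA : A * Matrix.diagonal (fun i => (γ i : ℂ)) = Matrix.diagonal (fun i => (γ i : ℂ)) * A) :
    (Matrix.of fun i j => if γ i = γ j then A i j else 0) = A := by
  ext i j
  rw [Matrix.of_apply]
  split_ifs with h
  · rfl
  · have := congr_fun (congr_fun hA i) j
    rw [mul_diagonal, diagonal_mul] at this
    have hne : (γ j : ℂ) ≠ (γ i : ℂ) := fun h' => h (Units.val_injective h').symm
    have : A i j * ((γ j : ℂ) - γ i) = 0 := by rw [mul_sub, this]; ring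
    rcases mul_eq_zero.mp this with h0 | h0
    · exact h0.symm
    · exact absurd (sub_eq_zero.mp h0) hne

/-! ### §3 The universal orbit family -/

variable {r : ℕ} (v : Fin r → MvPolynomial (Fin (n + 2)) ℂ)

/-- **Specialisation of the universal orbit family**: at the point `x = (A, b)` the universal coefficient
`coeff_m (Y_γ · Σₜ X_{bₜ} vₜ)` evaluates to `coeff_m (A_γ · Σₜ bₜ vₜ)`.
[cite: GelfandKapranovZelevinsky1994, Ch. 1 §1 (the discriminant hypersurface)] -/
theorem eval_orbitFamilyCoeff (m : Fin (n + 2) →₀ ℕ) (x : ((Fin (n + 2) × Fin (n + 2)) ⊕ Fin r) → ℂ) :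
    MvPolynomial.eval x (coeff m (linSubst (Fin (n + 2)) (MvPolynomial (((Fin (n + 2) × Fin (n + 2)) ⊕ Fin r)) ℂ)
        (Matrix.of fun i j => if γ i = γ j then X (Sum.inl (i, j)) else 0)
        (∑ t, (X (Sum.inr t) : MvPolynomial (((Fin (n + 2) × Fin (n + 2)) ⊕ Fin r)) ℂ) • MvPolynomial.map (C : ℂ →+* MvPolynomial (((Fin (n + 2) × Fin (n + 2)) ⊕ Fin r)) ℂ) (v t)))) =
      coeff m (linSubst (Fin (n + 2)) ℂ
        (Matrix.of fun i j => if γ i = γ j then x (Sum.inl (i, j)) else 0) (∑ t, x (Sum.inr t) • v t)) := by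
  have hA : (Matrix.of fun i j => if γ i = γ j then
        (X (Sum.inl (i, j)) : MvPolynomial (((Fin (n + 2) × Fin (n + 2)) ⊕ Fin r)) ℂ) else 0).map
      (MvPolynomial.eval x) = Matrix.of fun i j => if γ i = γ j then x (Sum.inl (i, j)) else 0 := by
    ext i j
    rw [Matrix.map_apply, Matrix.of_apply, Matrix.of_apply]
    split_ifs <;> simp
  have hF : MvPolynomial.map (MvPolynomial.eval x)
      (∑ t, (X (Sum.inr t) : MvPolynomial (((Fin (n + 2) × Fin (n + 2)) ⊕ Fin r)) ℂ) • MvPolynomial.map (C : ℂ →+* MvPolynomial (((Fin (n + 2) × Fin (n + 2)) ⊕ Fin r)) ℂ) (v t)) =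
      ∑ t, x (Sum.inr t) • v t := by
    rw [map_sum]
    refine Finset.sum_congr rfl fun t _ => ?_
    rw [smul_eq_C_mul, map_mul, map_C, eval_X, MvPolynomial.map_map, smul_eq_C_mul]
    congr 1
    have : (MvPolynomial.eval x).comp (C : ℂ →+* MvPolynomial (((Fin (n + 2) × Fin (n + 2)) ⊕ Fin r)) ℂ) =
        RingHom.id ℂ := RingHom.ext fun c => eval_C c
    rw [this, MvPolynomial.map_id]
  rw [← coeff_map, map_linSubst, hA, hF]

/-- **The range of the orbit family**: the coefficient vectors (read on `M`) of all `A_γ · F`, `A` any matrix,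
`F` any `ℂ`-combination of the `vₜ`. [cite: GelfandKapranovZelevinsky1994, Ch. 1 §1 (the discriminant hypersurface)] -/
theorem mem_range_orbitFamily_iff (a : M → ℂ) :
    a ∈ Set.range (fun x : ((Fin (n + 2) × Fin (n + 2)) ⊕ Fin r) → ℂ => fun m : M =>
        MvPolynomial.aeval x (coeff m.1.1 (linSubst (Fin (n + 2))
          (MvPolynomial (((Fin (n + 2) × Fin (n + 2)) ⊕ Fin r)) ℂ)
          (Matrix.of fun i j => if γ i = γ j then X (Sum.inl (i, j)) else 0)
          (∑ t, (X (Sum.inr t) : MvPolynomial (((Fin (n + 2) × Fin (n + 2)) ⊕ Fin r)) ℂ) • MvPolynomial.map (C : ℂ →+* MvPolynomial (((Fin (n + 2) × Fin (n + 2)) ⊕ Fin r)) ℂ) (v t))))) ↔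
      ∃ (A : Matrix (Fin (n + 2)) (Fin (n + 2)) ℂ) (b : Fin r → ℂ),
        a = fun m : M => coeff m.1.1 (linSubst (Fin (n + 2)) ℂ
          (Matrix.of fun i j => if γ i = γ j then A i j else 0) (∑ t, b t • v t)) := by
  constructor
  · rintro ⟨x, rfl⟩
    refine ⟨Matrix.of fun i j => x (Sum.inl (i, j)), fun t => x (Sum.inr t), ?_⟩
    funext m
    exact (DFunLike.congr_fun (coe_aeval_eq_eval x) _).trans (eval_orbitFamilyCoeff γ v m.1.1 x)
  · rintro ⟨A, b, rfl⟩
    refine ⟨Sum.elim (fun ij => A ij.1 ij.2) b, ?_⟩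
    funext m
    exact (DFunLike.congr_fun (coe_aeval_eq_eval _) _).trans (eval_orbitFamilyCoeff γ v m.1.1 _)

/-- **The range is irreducible**: its vanishing ideal is prime (image of a polynomial map).
[cite: Hartshorne1977, I Ex. 1.1.3] -/
theorem isPrime_vanishingIdeal_range_orbitFamily :
    (vanishingIdeal ℂ (Set.range (fun x : ((Fin (n + 2) × Fin (n + 2)) ⊕ Fin r) → ℂ => fun m : M =>
        MvPolynomial.aeval x (coeff m.1.1 (linSubst (Fin (n + 2))
          (MvPolynomial (((Fin (n + 2) × Fin (n + 2)) ⊕ Fin r)) ℂ)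
          (Matrix.of fun i j => if γ i = γ j then X (Sum.inl (i, j)) else 0)
          (∑ t, (X (Sum.inr t) : MvPolynomial (((Fin (n + 2) × Fin (n + 2)) ⊕ Fin r)) ℂ) • MvPolynomial.map (C : ℂ →+* MvPolynomial (((Fin (n + 2) × Fin (n + 2)) ⊕ Fin r)) ℂ) (v t))))))).IsPrime :=
  SignSymmetricPowersMeridianIrreducible.isPrime_vanishingIdeal_range _

/-! ### §4 The range lies in `V(D_M)` -/

variable {γ M v}

/-- **Every member of the orbit family is a singular `M`-form**, so `D_M = killHom Disc` vanishes on the range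
(`d ≥ 2`; `M` = the monomials fixed by `γ`; every `vₜ` an `M`-supported degree-`d` form with `∇vₜ(p) = 0`, `p ≠ 0`).
[cite: GelfandKapranovZelevinsky1994, Ch. 1 §1 (the discriminant hypersurface)] -/
theorem killHom_mem_vanishingIdeal_range_orbitFamily [DecidablePred (· ∈ M)] (hd : 2 ≤ d)
    (hM : ∀ m : DegIndex n d, m ∈ M ↔ unitWeight ℂ n γ m.1 = 1)
    {Disc : MvPolynomial (DegIndex n d) ℂ}
    (hV : ∀ a : DegIndex n d → ℂ, a ∈ singularCoeffs n d ↔ MvPolynomial.eval a Disc = 0)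
    {p : Fin (n + 2) → ℂ} (hp : p ≠ 0) (hvh : ∀ t, (v t).IsHomogeneous d) (hvM : ∀ t, IsSupportedOn n d M (v t))
    (hvp : ∀ t j, MvPolynomial.eval p (pderiv j (v t)) = 0) :
    killHom ℂ n d M Disc ∈ vanishingIdeal ℂ (Set.range (fun x : ((Fin (n + 2) × Fin (n + 2)) ⊕ Fin r) → ℂ =>
      fun m : M => MvPolynomial.aeval x (coeff m.1.1 (linSubst (Fin (n + 2))
          (MvPolynomial (((Fin (n + 2) × Fin (n + 2)) ⊕ Fin r)) ℂ)
          (Matrix.of fun i j => if γ i = γ j then X (Sum.inl (i, j)) else 0)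
          (∑ t, (X (Sum.inr t) : MvPolynomial (((Fin (n + 2) × Fin (n + 2)) ⊕ Fin r)) ℂ) • MvPolynomial.map (C : ℂ →+* MvPolynomial (((Fin (n + 2) × Fin (n + 2)) ⊕ Fin r)) ℂ) (v t)))))) := by
  classical
  rw [mem_vanishingIdeal_iff]
  intro a ha
  obtain ⟨A, b, rfl⟩ := (mem_range_orbitFamily_iff γ M v a).mp ha
  set B : Matrix (Fin (n + 2)) (Fin (n + 2)) ℂ := (Matrix.of fun i j => if γ i = γ j then A i j else 0) with hB
  set F : MvPolynomial (Fin (n + 2)) ℂ := ∑ t, b t • v t with hFdef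
  -- `F` is an `M`-form singular at `p`
  have hFh : F.IsHomogeneous d := by
    rw [hFdef]
    refine IsHomogeneous.sum _ _ _ fun t _ => ?_
    rw [smul_eq_C_mul]
    exact (hvh t).C_mul _
  have hFM : IsSupportedOn n d M F := by
    intro m hm
    rw [hFdef, coeff_sum]
    exact Finset.sum_eq_zero fun t _ => by rw [coeff_smul, hvM t m hm, smul_zero]
  have hFp : ∀ j, MvPolynomial.eval p (pderiv j F) = 0 := by
    intro j
    rw [hFdef, map_sum, map_sum]
    exact Finset.sum_eq_zero fun t _ => by
      rw [(pderiv j).map_smul, smul_eval, hvp t j, mul_zero]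
  -- `G = B · F` is an `M`-form and singular
  have hBc := blockify_commute γ A
  have hFinv : aeval (diagSubstK ℂ n γ) F = F := (isSupportedOn_iff_aeval_diagSubstK_eq γ M hM hFh).mp hFM
  have hGh : (linSubst (Fin (n + 2)) ℂ B F).IsHomogeneous d := linSubst_isHomogeneous B hFh
  have hGM : IsSupportedOn n d M (linSubst (Fin (n + 2)) ℂ B F) :=
    (isSupportedOn_iff_aeval_diagSubstK_eq γ M hM hGh).mpr (linSubst_invariant_of_commute γ hBc hFinv)
  have hsing := coeffsOf_linSubst_mem_singularCoeffs hd hFh hp hFp B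
  rw [hV] at hsing
  refine (DFunLike.congr_fun (coe_aeval_eq_eval _) _).trans ?_
  rw [eval_killHom, extend_coeffM_eq_coeffsOf n d M hGM]
  exact hsing.symm ▸ rfl

/-! ### §5 Every invariant form with a singular point of the right type is in the range -/

/-- **Moving the singular point to the reference point.**  Let `f` be an `M`-supported degree-`d` form with
`∇f(z) = 0`, and `N` an invertible matrix commuting with `diagonal γ` with `N z = p`.  If the family `v` SPANS the
`M`-supported degree-`d` forms singular at `p`, then `coeff_M f` lies in the range of the orbit family of `v`
(`f = Nᵀ · F` with `F = (Nᵀ)⁻¹ · f` singular at `p`). [cite: Hartshorne1977, I Ex. 5.8] -/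
theorem mem_range_orbitFamily_of_transit (hM : ∀ m : DegIndex n d, m ∈ M ↔ unitWeight ℂ n γ m.1 = 1)
    {p : Fin (n + 2) → ℂ}
    (hspan : ∀ F : MvPolynomial (Fin (n + 2)) ℂ, F.IsHomogeneous d → IsSupportedOn n d M F →
      (∀ j, MvPolynomial.eval p (pderiv j F) = 0) → ∃ b : Fin r → ℂ, F = ∑ t, b t • v t)
    {f : MvPolynomial (Fin (n + 2)) ℂ} (hf : f.IsHomogeneous d) (hfM : IsSupportedOn n d M f)
    {z : Fin (n + 2) → ℂ} (hfz : ∀ j, MvPolynomial.eval z (pderiv j f) = 0)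
    {N : Matrix (Fin (n + 2)) (Fin (n + 2)) ℂ}
    (hN : N * Matrix.diagonal (fun i => (γ i : ℂ)) = Matrix.diagonal (fun i => (γ i : ℂ)) * N)
    (hNdet : IsUnit N.det) (hNz : N *ᵥ z = p) :
    (fun m : M => coeff m.1.1 f) ∈ Set.range (fun x : ((Fin (n + 2) × Fin (n + 2)) ⊕ Fin r) → ℂ =>
      fun m : M => MvPolynomial.aeval x (coeff m.1.1 (linSubst (Fin (n + 2))
          (MvPolynomial (((Fin (n + 2) × Fin (n + 2)) ⊕ Fin r)) ℂ)
          (Matrix.of fun i j => if γ i = γ j then X (Sum.inl (i, j)) else 0)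
          (∑ t, (X (Sum.inr t) : MvPolynomial (((Fin (n + 2) × Fin (n + 2)) ⊕ Fin r)) ℂ) • MvPolynomial.map (C : ℂ →+* MvPolynomial (((Fin (n + 2) × Fin (n + 2)) ⊕ Fin r)) ℂ) (v t))))) := by
  classical
  set D : Matrix (Fin (n + 2)) (Fin (n + 2)) ℂ := Matrix.diagonal (fun i => (γ i : ℂ)) with hD
  set A : Matrix (Fin (n + 2)) (Fin (n + 2)) ℂ := Nᵀ with hAdef
  have hA : A * D = D * A := by
    have := congr_arg Matrix.transpose hN
    rw [Matrix.transpose_mul, Matrix.transpose_mul, hD, diagonal_transpose] at this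
    rw [hAdef, hD]
    exact this.symm
  have hAdet : IsUnit A.det := by rw [hAdef, det_transpose]; exact hNdet
  have hAinv : A⁻¹ * D = D * A⁻¹ := nonsing_inv_commute hAdet hA
  -- `F := A⁻¹ · f`
  set F := linSubst (Fin (n + 2)) ℂ A⁻¹ f with hFdef
  have hfinv : aeval (diagSubstK ℂ n γ) f = f := (isSupportedOn_iff_aeval_diagSubstK_eq γ M hM hf).mp hfM
  have hFh : F.IsHomogeneous d := linSubst_isHomogeneous _ hf
  have hFM : IsSupportedOn n d M F :=
    (isSupportedOn_iff_aeval_diagSubstK_eq γ M hM hFh).mpr (linSubst_invariant_of_commute γ hAinv hfinv)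
  have hFp : ∀ j, MvPolynomial.eval p (pderiv j F) = 0 := by
    intro j
    refine eval_pderiv_linSubst_eq_zero A⁻¹ (fun l => ?_) j
    have hmove : (A⁻¹)ᵀ *ᵥ p = z := by
      rw [transpose_nonsing_inv, hAdef, transpose_transpose, ← hNz, mulVec_mulVec, nonsing_inv_mul _ hNdet,
        one_mulVec]
    rw [hmove]
    exact hfz l
  obtain ⟨b, hb⟩ := hspan F hFh hFM hFp
  have hfAF : f = linSubst (Fin (n + 2)) ℂ A F := by rw [hFdef, linSubst_linSubst_nonsing_inv hAdet]
  rw [mem_range_orbitFamily_iff]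
  refine ⟨A, b, ?_⟩
  rw [blockify_eq_of_commute γ hA, ← hb, ← hfAF]

end Summit.HodgeConjecture.HodgeConjecture.Theorems.SignSymmetricPowersGenSingularFamilies

end
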